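import Literature.Computability.Cryptography.BLPRSReduction
import Literature.Computability.Cryptography.LWERegevAsymptotics
import Mathlib.Analysis.SpecialFunctions.Pow.Real
import HarnessLib

/-!
# The parameter schedule of the Micciancio–Peikert reduction in BLPRS's setting, and its asymptotics (MP12 Thm. 3.1 / BLPRS Thm. 2.17)

Topic `Computability/Cryptography` (LWE), grouping namespace `LWE.MP12`; companion of
`LWEPrimePowerParams.lean` (the failure bound `idealLaw_gaussian_ne_le` of the reduction in the
parameters `e, K, N, T, N', m', ε'` and a known advantage lower bound). Proved material (no named
fact) towards `Literature.Computability.Cryptography.blprs_gapSVP_sqrt_dim_to_lwe_classical`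
(**pqc.S21**), component Thm. 2.17 = Micciancio–Peikert 2012, Thm. 3.1 (hypothesis `h₂` of
`BLPRSReduction.blprs_gapSVP_sqrt_dim_to_lwe_classical_of_components`): in BLPRS's setting
(`BLPRS2013.dim n = ⌊√n⌋`, `modulus n = 2^{⌊√n⌋/2+2}`, `rate₂ α n = α n/(8⌊√n⌋)`,
`rate₁ α n = rate₂ α n/(⌊log₂ n⌋+1)²`) this file fixes the schedule as explicit functions of `n` and of
the advantage exponent `c` (all natural numbers, so that the machine computes them) and proves the
four terms of the failure bound small for all large `n`:

* `lev n = ⌊√n⌋/2 + 2` (`Q = 2^{lev n}`), `logK n = ⌊log₂ n⌋ + 1`, `aggK n = logK n ^ 4` (so that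
  `√K · rate₁ = rate₂`: `sqrt_aggK_mul_rate₁`), `invGap c n = 8·lev n·nᶜ` (`γ = 1/invGap`, the
  advantage lower bound being `adv₀ c n = 1/(2nᶜ)`), `slack n = 24·dim n·lev n`,
  `trials c n = 2·slack·invGap`, `reps c n = 8·trials·slack·invGap²`, `meas c n = 768(lev n+1)³n^{2c}`,
  `extra n = dim n + 4`, `epsC c m n = 1/(32·lev n·(m+1)·nᶜ)`;
* `est_term_le` (`(e+1)/(4N'η²) ≤ 1/12`), `digit_terms_le` (`(1-γ+8/(Nγ²))ᵀ + 8T/(Nγ²) ≤ 2/slack`),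
  `round_term_le` (`(2ᵈ-1)/2^{d+4} ≤ 1/16`);
* the asymptotics: `eventually_mul_pow_le_two_pow_lev` (`A·nᵏ ≤ 2^{lev n}` eventually),
  **`eventually_closeness`** (`2(m·ΔK + m·ε'/(1-ε')) < adv₀/(2e)` and `adv₀ + m·ΔK ≤ 1/nᶜ`),
  **`eventually_tail`** (`0 ≤ r₀` and `extra·2e^{-πr₀²/rate₁²} ≤ 1/16`), under `q`, `m` polynomially
  bounded and BLPRS's hypothesis `√n·log n ≤ α n·q n`, `0 < α n < 1` eventually.

## References

* D. Micciancio, C. Peikert, *Trapdoors for lattices: simpler, tighter, faster, smaller*, EUROCRYPT 2012,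
  LNCS 7237; full version IACR ePrint 2011/501, §3, Thm. 3.1 (the parameters `ℓ = ω(log n)`, `α' ≥ η_ε(ℤ)`
  and the proof, pp. 15–16). [MicciancioPeikert2012]
* Z. Brakerski, A. Langlois, C. Peikert, O. Regev, D. Stehlé, *Classical hardness of learning with
  errors*, STOC 2013 (arXiv:1306.0281), Thm. 2.17 and the proof of Thm. 1.1 (the choice `k = ⌊√n⌋`,
  `q = 2^{k/2+O(1)}`). [BrakerskiEtAl2013]
-/

noncomputable section

namespace Literature.Computability.Cryptography

namespace LWE

namespace MP12

open Real Filter BLPRS2013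

/-! ### The schedule -/

/-- The exponent of the modulus: `Q = 2^{lev n}`, `lev n = ⌊√n⌋/2 + 2`. [cite: BrakerskiEtAl2013, proof of Thm. 1.1] -/
def lev (n : ℕ) : ℕ := dim n / 2 + 2

/-- `⌊log₂ n⌋ + 1`, the square root of the noise ratio `rate₂/rate₁`. [cite: BrakerskiEtAl2013, Thm. 2.17 (`ℓ = ω(log n)`)] -/
def logK (n : ℕ) : ℕ := Nat.log 2 n + 1

/-- The number of raw samples summed into one: `K = (⌊log₂ n⌋ + 1)⁴`. [cite: MicciancioPeikert2012, Thm. 3.1 proof (p. 15, first step)] -/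
def aggK (n : ℕ) : ℕ := logK n ^ 4

/-- The inverse of the test accuracy `γ`: `8·e·nᶜ`. [cite: MicciancioPeikert2012, Thm. 3.1 proof (p. 15)] -/
def invGap (c n : ℕ) : ℕ := 8 * lev n * n ^ c

/-- The advantage lower bound the machine works with: `1/(2nᶜ)`. [cite: RegevLWE2009, §4 Lemma 4.1 (proof)] -/
def adv₀ (c n : ℕ) : ℝ := 1 / (2 * (n : ℝ) ^ c)

/-- The test accuracy `γ = adv₀/(4e) = 1/invGap`. [cite: MicciancioPeikert2012, Thm. 3.1 proof (p. 15)] -/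
def gap (c n : ℕ) : ℝ := 1 / (invGap c n : ℝ)

/-- The slack `X = 24·d·e` of the digit terms. [folklore] -/
def slack (n : ℕ) : ℕ := 24 * dim n * lev n

/-- The number of trials of one test: `T = 2·X·invGap`. [cite: RegevLWE2009, §4 Lemma 4.1 (proof)] -/
def trials (c n : ℕ) : ℕ := 2 * slack n * invGap c n

/-- The number of oracle calls per estimate: `N = 8·T·X·invGap²`. [cite: RegevLWE2009, §4 Lemma 4.1 (proof)] -/
def reps (c n : ℕ) : ℕ := 8 * trials c n * slack n * invGap c n ^ 2

/-- The number of measurements per level: `N' = 768·(e+1)³·n^{2c}`. [cite: MicciancioPeikert2012, Thm. 3.1 proof (p. 15)] -/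
def meas (c n : ℕ) : ℕ := 768 * (lev n + 1) ^ 3 * n ^ (2 * c)

/-- The number of raw samples rounded at the end: `m' = d + 4`. [cite: MicciancioPeikert2012, Thm. 3.1 proof (p. 16)] -/
def extra (n : ℕ) : ℕ := dim n + 4

/-- The smoothing slack `ε' = 1/(32·e·(m+1)·nᶜ)`. [cite: MicciancioPeikert2012, Lemma 2.4] -/
def epsC (c m n : ℕ) : ℝ := 1 / (32 * (lev n : ℝ) * (m + 1) * (n : ℝ) ^ c)

/-- The smoothing threshold `θ = √(ln(2(1+1/ε'))/π)`. [cite: MicciancioPeikert2012, Lemma 2.4] -/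
def theta (c m n : ℕ) : ℝ := Real.sqrt (Real.log (2 * (1 + 1 / epsC c m n)) / π)

/-! ### Elementary bounds -/

/-- `dim n ≤ n`. [folklore] -/
theorem dim_le (n : ℕ) : dim n ≤ n := Nat.sqrt_le_self n

/-- `1 ≤ dim n` for `n ≥ 1`. [folklore] -/
theorem one_le_dim {n : ℕ} (hn : 1 ≤ n) : 1 ≤ dim n := Nat.le_sqrt.2 (by simpa using hn)

/-- `2 ≤ lev n`. [folklore] -/
theorem two_le_lev (n : ℕ) : 2 ≤ lev n := Nat.le_add_left _ _

/-- `0 < lev n`. [folklore] -/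
theorem lev_pos (n : ℕ) : 0 < lev n := lt_of_lt_of_le (by norm_num) (two_le_lev n)

/-- `lev n ≤ n + 2`. [folklore] -/
theorem lev_le (n : ℕ) : lev n ≤ n + 2 := by
  have := dim_le n
  unfold lev
  omega

/-- `n ≤ 4·lev²`. [folklore] -/
theorem le_four_mul_lev_sq (n : ℕ) : n ≤ 4 * lev n ^ 2 := by
  have h1 : n < (dim n + 1) ^ 2 := by
    have := Nat.lt_succ_sqrt n
    unfold dim
    nlinarith
  have h2 : dim n + 1 ≤ 2 * lev n := by unfold lev; omega
  calc n ≤ (dim n + 1) ^ 2 := h1.le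
    _ ≤ (2 * lev n) ^ 2 := Nat.pow_le_pow_left h2 2
    _ = 4 * lev n ^ 2 := by ring

/-- BLPRS's modulus is `2^{lev n}`. [folklore] -/
theorem modulus_eq (n : ℕ) : modulus n = 2 ^ lev n := rfl

/-- `ln n ≤ ⌊log₂ n⌋ + 1`. [folklore] -/
theorem log_le_logK (n : ℕ) : Real.log n ≤ logK n := by
  rcases Nat.eq_zero_or_pos n with rfl | hn
  · simp [logK]
  have h1 : (n : ℝ) < 2 ^ (logK n) := by
    unfold logK
    exact_mod_cast Nat.lt_pow_succ_log_self one_lt_two n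
  have h2 : Real.log n < logK n * Real.log 2 := by
    rw [← Real.log_pow]
    exact Real.log_lt_log (by exact_mod_cast hn) (by exact_mod_cast h1)
  have h3 : Real.log 2 ≤ 1 := by
    have := Real.log_two_lt_d9
    linarith
  have h4 : (0 : ℝ) ≤ logK n := by positivity
  nlinarith

/-- `1 ≤ logK n`. [folklore] -/
theorem one_le_logK (n : ℕ) : 1 ≤ logK n := Nat.le_add_left _ _

/-- `logK n ≤ n + 1`. [folklore] -/
theorem logK_le (n : ℕ) : logK n ≤ n + 1 := by
  rcases Nat.eq_zero_or_pos n with rfl | hn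
  · simp [logK]
  · have := Nat.log_lt_self 2 hn.ne'
    unfold logK
    omega

/-- `1 ≤ aggK n`. [folklore] -/
theorem one_le_aggK (n : ℕ) : 1 ≤ aggK n := Nat.one_le_pow _ _ (one_le_logK n)

/-- **`√K · rate₁ = rate₂`.** [cite: MicciancioPeikert2012, Thm. 3.1 (the rates `α` and `α' = √K·α`)] -/
theorem sqrt_aggK_mul_rate₁ (α : ℕ → ℝ) (n : ℕ) : Real.sqrt (aggK n) * rate₁ α n = rate₂ α n := by
  have hL : (0 : ℝ) < logK n := by exact_mod_cast one_le_logK n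
  have hsq : Real.sqrt (aggK n) = (logK n : ℝ) ^ 2 := by
    rw [aggK, Nat.cast_pow, show ((logK n : ℝ)) ^ 4 = ((logK n : ℝ) ^ 2) ^ 2 by ring,
      Real.sqrt_sq (by positivity)]
  rw [hsq, rate₁, show ((Nat.log 2 n + 1 : ℕ) : ℝ) = logK n from rfl]
  field_simp

/-- `0 < invGap c n` for `n ≥ 1`. [folklore] -/
theorem invGap_pos {c n : ℕ} (hn : 1 ≤ n) : 0 < invGap c n := by
  unfold invGap
  have := lev_pos n
  positivity

/-- `0 < slack n` for `n ≥ 1`. [folklore] -/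
theorem slack_pos {n : ℕ} (hn : 1 ≤ n) : 0 < slack n := by
  unfold slack
  have := lev_pos n
  have := one_le_dim hn
  positivity

/-- `0 < trials c n` for `n ≥ 1`. [folklore] -/
theorem trials_pos {c n : ℕ} (hn : 1 ≤ n) : 0 < trials c n := by
  unfold trials
  have := slack_pos hn
  have := invGap_pos (c := c) hn
  positivity

/-- `0 < reps c n` for `n ≥ 1`. [folklore] -/
theorem reps_pos {c n : ℕ} (hn : 1 ≤ n) : 0 < reps c n := by
  unfold reps
  have := slack_pos hn
  have := invGap_pos (c := c) hn
  have := trials_pos (c := c) hn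
  positivity

/-- `0 < meas c n` for `n ≥ 1`. [folklore] -/
theorem meas_pos {c n : ℕ} (hn : 1 ≤ n) : 0 < meas c n := by
  unfold meas
  have : 0 < n := hn
  positivity

/-- `γ = adv₀/(4e)`. [folklore] -/
theorem gap_eq {c n : ℕ} (hn : 1 ≤ n) : gap c n = adv₀ c n / (4 * (lev n : ℝ)) := by
  have : (0 : ℝ) < n := by exact_mod_cast hn
  have := lev_pos n
  unfold gap adv₀ invGap
  push_cast
  field_simp
  ring

/-- `0 < adv₀ c n` for `n ≥ 1`. [folklore] -/
theorem adv₀_pos {c n : ℕ} (hn : 1 ≤ n) : 0 < adv₀ c n := by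
  have : (0 : ℝ) < n := by exact_mod_cast hn
  unfold adv₀
  positivity

/-- `0 < gap c n` for `n ≥ 1`. [folklore] -/
theorem gap_pos {c n : ℕ} (hn : 1 ≤ n) : 0 < gap c n := by
  unfold gap
  have := invGap_pos (c := c) hn
  positivity

/-! ### The three elementary terms -/

/-- **The measurement term**: `(e+1)·1/(4N'η²) ≤ 1/12` with `η = adv₀/(8e)`. [cite: MicciancioPeikert2012, Thm. 3.1 proof (p. 15)] -/
theorem est_term_le {c n : ℕ} (hn : 1 ≤ n) :
    (lev n + 1 : ℕ) * (1 / (4 * (meas c n : ℝ) * (adv₀ c n / (8 * (lev n : ℝ))) ^ 2)) ≤ 1 / 12 := by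
  have hn' : (0 : ℝ) < n := by exact_mod_cast hn
  have he : (1 : ℝ) ≤ lev n := by exact_mod_cast lev_pos n
  unfold meas adv₀
  push_cast
  rw [show (4 : ℝ) * (768 * ((lev n : ℝ) + 1) ^ 3 * (n : ℝ) ^ (2 * c)) * (1 / (2 * (n : ℝ) ^ c) / (8 * lev n)) ^ 2 =
      12 * ((lev n : ℝ) + 1) ^ 3 / (lev n : ℝ) ^ 2 by rw [pow_mul]; field_simp; ring]
  rw [one_div_div, ← mul_div_assoc, div_le_div_iff₀ (by positivity) (by positivity)]
  nlinarith [pow_pos (show (0 : ℝ) < lev n by linarith) 2, mul_le_mul he he (by linarith) (by linarith)]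

/-- `8/(Nγ²) = 1/(T·X)` and `8T/(Nγ²) = 1/X`. [folklore] -/
theorem reps_identities {c n : ℕ} (hn : 1 ≤ n) :
    8 / ((reps c n : ℝ) * gap c n ^ 2) = 1 / ((trials c n : ℝ) * slack n) ∧
      (trials c n : ℝ) * (8 / ((reps c n : ℝ) * gap c n ^ 2)) = 1 / (slack n : ℝ) := by
  have hG : (0 : ℝ) < invGap c n := by exact_mod_cast invGap_pos hn
  have hX : (0 : ℝ) < slack n := by exact_mod_cast slack_pos hn
  have hT : (0 : ℝ) < trials c n := by exact_mod_cast trials_pos hn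
  unfold gap reps
  push_cast
  constructor
  · field_simp
  · field_simp

/-- **The digit terms**: `(1 - γ + 8/(Nγ²))ᵀ + T·8/(Nγ²) ≤ 2/X`. [cite: MicciancioPeikert2012, Thm. 3.1 proof (p. 16) with RegevLWE2009 §4] -/
theorem digit_terms_le {c n : ℕ} (hn : 1 ≤ n) :
    (1 - gap c n + 8 / ((reps c n : ℝ) * gap c n ^ 2)) ^ trials c n +
        (trials c n : ℝ) * (8 / ((reps c n : ℝ) * gap c n ^ 2)) ≤ 2 / (slack n : ℝ) := by
  obtain ⟨h1, h2⟩ := reps_identities (c := c) hn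
  have hX : (0 : ℝ) < slack n := by exact_mod_cast slack_pos hn
  have hT : (0 : ℝ) < trials c n := by exact_mod_cast trials_pos hn
  have hγ := gap_pos (c := c) hn
  have hγ1 : gap c n ≤ 1 := by
    unfold gap
    rw [div_le_one (by exact_mod_cast invGap_pos hn)]
    exact_mod_cast invGap_pos (c := c) hn
  rw [h2, h1]
  -- `γ·T = 2X` and `1/(TX) ≤ γ/2`
  have hγT : gap c n * trials c n = 2 * slack n := by
    have hG : (0 : ℝ) < invGap c n := by exact_mod_cast invGap_pos hn
    unfold gap trials
    push_cast
    field_simp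
  have hsmall : 1 / ((trials c n : ℝ) * slack n) ≤ gap c n / 2 := by
    rw [div_le_div_iff₀ (by positivity) (by norm_num), one_mul]
    have hX1 : (1 : ℝ) ≤ slack n := by exact_mod_cast slack_pos hn
    nlinarith
  have hbase : (1 - gap c n + 1 / ((trials c n : ℝ) * slack n)) ^ trials c n ≤ 1 / (slack n : ℝ) := by
    calc (1 - gap c n + 1 / ((trials c n : ℝ) * slack n)) ^ trials c n
        ≤ (1 - gap c n / 2) ^ trials c n := by
          refine pow_le_pow_left₀ ?_ (by linarith) _
          have : 0 ≤ 1 / ((trials c n : ℝ) * slack n) := by positivity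
          linarith
      _ ≤ Real.exp (-(gap c n / 2)) ^ trials c n := by
          refine pow_le_pow_left₀ (by linarith) ?_ _
          have := Real.add_one_le_exp (-(gap c n / 2))
          linarith
      _ = Real.exp (-(slack n : ℝ)) := by
          rw [← Real.exp_nat_mul, show (trials c n : ℝ) * -(gap c n / 2) = -(slack n : ℝ) by linarith]
      _ ≤ 1 / (slack n : ℝ) := by
          rw [Real.exp_neg, one_div, inv_le_inv₀ (Real.exp_pos _) hX]
          have := Real.add_one_le_exp (slack n : ℝ)
          linarith
  calc _ ≤ 1 / (slack n : ℝ) + 1 / (slack n : ℝ) := add_le_add hbase le_rfl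
    _ = 2 / (slack n : ℝ) := by ring

/-- **The rounding term**: `(2ᵈ - 1)/2^{d+4} ≤ 1/16`. [folklore] -/
theorem round_term_le (n : ℕ) : ((2 ^ dim n - 1 : ℕ) : ℝ) / (2 ^ extra n : ℕ) ≤ 1 / 16 := by
  unfold extra
  rw [div_le_div_iff₀ (by positivity) (by norm_num), one_mul]
  have h : ((2 ^ dim n - 1 : ℕ) : ℝ) ≤ (2 : ℝ) ^ dim n := by
    have : 2 ^ dim n - 1 ≤ 2 ^ dim n := Nat.sub_le _ _
    exact_mod_cast this
  push_cast
  rw [pow_add]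
  nlinarith [pow_pos (show (0 : ℝ) < 2 by norm_num) (dim n)]

/-! ### Powers of `n` against `2^{lev n}` -/

/-- `lev n → ∞`. [folklore] -/
theorem tendsto_lev_atTop : Tendsto lev atTop atTop := by
  refine tendsto_atTop_atTop.2 fun b => ⟨(2 * b) ^ 2, fun n hn => ?_⟩
  unfold lev dim
  have : 2 * b ≤ Nat.sqrt n := by
    rw [Nat.le_sqrt]
    simpa [pow_two] using hn
  omega

/-- **`A·nᵏ ≤ 2^{lev n}` for all large `n`** (`n ≤ 4·lev²` and powers are `o(2^j)`). [folklore] -/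
theorem eventually_mul_pow_le_two_pow_lev (k : ℕ) (A : ℝ) :
    ∀ᶠ n : ℕ in atTop, A * (n : ℝ) ^ k ≤ (2 : ℝ) ^ lev n := by
  rcases le_or_gt A 0 with hA | hA
  · exact Eventually.of_forall fun n => (mul_nonpos_of_nonpos_of_nonneg hA (by positivity)).trans (by positivity)
  have h := (RegevReduction.eventually_mul_pow_le_two_pow (2 * k) (A * 4 ^ k))
  filter_upwards [tendsto_lev_atTop.eventually h] with n hn
  refine le_trans ?_ hn
  have h4 : (n : ℝ) ≤ 4 * (lev n : ℝ) ^ 2 := by exact_mod_cast le_four_mul_lev_sq n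
  calc A * (n : ℝ) ^ k ≤ A * (4 * (lev n : ℝ) ^ 2) ^ k := by gcongr
    _ = A * 4 ^ k * (lev n : ℝ) ^ (2 * k) := by rw [mul_pow, pow_mul]; ring


/-! ### Eventual bounds on the given parameters -/

section Eventually

variable (c : ℕ) {q m : ℕ → ℕ} {α : ℕ → ℝ}
  (hα : ∀ᶠ n : ℕ in atTop, 0 < α n ∧ α n < 1 ∧ Real.sqrt n * Real.log n ≤ α n * q n)

include hα in
/-- **`α n ≥ 1/q n`, hence `≥ 1/n^{k}`, eventually** (`α·q ≥ √n·log n ≥ 1` for `n ≥ 3`). [cite: BrakerskiEtAl2013, Thm. 2.17 (hypothesis `αq ≥ √n·ω(log)`)] -/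
theorem eventually_pow_inv_le_alpha (hq : IsPolyBounded q) :
    ∃ k : ℕ, ∀ᶠ n : ℕ in atTop, 0 < α n ∧ α n < 1 ∧ 1 / (n : ℝ) ^ k ≤ α n ∧ 0 < q n ∧ (q n : ℝ) ≤ (n : ℝ) ^ k := by
  obtain ⟨k, hk⟩ := RegevReduction.IsPolyBounded.eventually_le_pow hq
  refine ⟨k, ?_⟩
  filter_upwards [hα, hk, eventually_ge_atTop 3] with n ⟨h0, h1, h2⟩ hqn hn3
  have hn : (3 : ℝ) ≤ n := by exact_mod_cast hn3
  have hsq : 1 ≤ Real.sqrt n := by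
    rw [Real.le_sqrt (by norm_num) (by linarith)]
    linarith
  have hlog : 1 ≤ Real.log n := by
    rw [Real.le_log_iff_exp_le (by linarith)]
    have := Real.exp_one_lt_d9
    linarith
  have h1le : 1 ≤ α n * q n := le_trans (by nlinarith) h2
  have hq0 : 0 < q n := by
    rcases Nat.eq_zero_or_pos (q n) with h | h
    · rw [h, Nat.cast_zero, mul_zero] at h1le
      linarith
    · exact h
  have hqr : (0 : ℝ) < q n := by exact_mod_cast hq0
  have hqk : (q n : ℝ) ≤ (n : ℝ) ^ k := by exact_mod_cast hqn
  refine ⟨h0, h1, ?_, hq0, hqk⟩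
  calc 1 / (n : ℝ) ^ k ≤ 1 / (q n : ℝ) := by gcongr
    _ ≤ α n := by rw [div_le_iff₀ hqr]; linarith

/-- Crude polynomial bounds on the schedule: `dim n, logK n, lev n ≤ n` for `n ≥ 2`. [folklore] -/
theorem crude_bounds {n : ℕ} (hn : 2 ≤ n) : dim n ≤ n ∧ logK n ≤ n ∧ lev n ≤ n := by
  refine ⟨dim_le n, ?_, ?_⟩
  · have := Nat.log_lt_self 2 (show n ≠ 0 by omega)
    unfold logK
    omega
  · unfold lev dim
    have h := Nat.sqrt_le_self n
    have h2 : Nat.sqrt n * Nat.sqrt n ≤ n := Nat.sqrt_le n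
    rcases Nat.lt_or_ge (Nat.sqrt n) 2 with h3 | h3
    · omega
    · have h4 : 2 * Nat.sqrt n ≤ n := by nlinarith
      omega

include hα in
/-- **The closeness conditions hold eventually**: `2(m·ΔK + m·ε'/(1-ε')) < adv₀/(2e)`,
`adv₀ + m·ΔK ≤ 1/nᶜ`, `0 < ε' < 1` (`ΔK = (K-1)/(2Q·rate₁)`). [cite: MicciancioPeikert2012, Thm. 3.1 proof (p. 15) with Lemma 2.4] -/
theorem eventually_closeness (hq : IsPolyBounded q) (hm : IsPolyBounded m) : ∀ᶠ n : ℕ in atTop,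
    2 * ((m n : ℝ) * (((aggK n : ℝ) - 1) / (2 * ((2 ^ lev n : ℕ) : ℝ) * rate₁ α n)) +
        (m n : ℝ) * (epsC c (m n) n / (1 - epsC c (m n) n))) < adv₀ c n / (2 * (lev n : ℝ)) ∧
      adv₀ c n + (m n : ℝ) * (((aggK n : ℝ) - 1) / (2 * ((2 ^ lev n : ℕ) : ℝ) * rate₁ α n)) ≤ 1 / (n : ℝ) ^ c ∧
      0 < epsC c (m n) n ∧ epsC c (m n) n < 1 := by
  obtain ⟨kq, hkq⟩ := eventually_pow_inv_le_alpha hα hq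
  obtain ⟨km, hkm⟩ := RegevReduction.IsPolyBounded.eventually_le_pow hm
  filter_upwards [hkq, hkm, eventually_ge_atTop 2, eventually_mul_pow_le_two_pow_lev (km + kq + c + 8) 128]
    with n ⟨hα0, hα1, hαk, hq0, hqk⟩ hmn hn2 hpow
  obtain ⟨hd, hL, he⟩ := crude_bounds hn2
  have hn : (2 : ℝ) ≤ n := by exact_mod_cast hn2
  have hn1 : (1 : ℝ) ≤ n := by linarith
  have hdr : (1 : ℝ) ≤ dim n := by exact_mod_cast one_le_dim (show 1 ≤ n by omega)
  have hdn : (dim n : ℝ) ≤ n := by exact_mod_cast hd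
  have hLn : (logK n : ℝ) ≤ n := by exact_mod_cast hL
  have hL1 : (1 : ℝ) ≤ logK n := by exact_mod_cast one_le_logK n
  have hen : (lev n : ℝ) ≤ n := by exact_mod_cast he
  have he2 : (2 : ℝ) ≤ lev n := by exact_mod_cast two_le_lev n
  have hmr : (m n : ℝ) ≤ (n : ℝ) ^ km := by exact_mod_cast hmn
  have hQ : (0 : ℝ) < ((2 ^ lev n : ℕ) : ℝ) := by positivity
  have hK1 : (1 : ℝ) ≤ aggK n := by exact_mod_cast one_le_aggK n
  have hKn : (aggK n : ℝ) ≤ (n : ℝ) ^ 4 := by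
    unfold aggK; push_cast; exact pow_le_pow_left₀ (by linarith) hLn 4
  have hnc : (1 : ℝ) ≤ (n : ℝ) ^ c := one_le_pow₀ hn1
  -- the rates
  have hr₂ : rate₂ α n = α n / (8 * dim n) := rfl
  have hr₁ : rate₁ α n = α n / (8 * dim n) / (logK n : ℝ) ^ 2 := rfl
  have hr₁pos : 0 < rate₁ α n := by rw [hr₁]; positivity
  -- `m·ΔK ≤ 1/(32·e·nᶜ)`
  have hΔ : (m n : ℝ) * (((aggK n : ℝ) - 1) / (2 * ((2 ^ lev n : ℕ) : ℝ) * rate₁ α n)) ≤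
      1 / (32 * (lev n : ℝ) * (n : ℝ) ^ c) := by
    -- it suffices that `128·m·K·d·logK²·e·nᶜ·(1/α) ≤ Q`, and `1/α ≤ n^{kq}`
    have hQpow : (128 : ℝ) * (n : ℝ) ^ (km + kq + c + 8) ≤ ((2 ^ lev n : ℕ) : ℝ) := by exact_mod_cast hpow
    have hprod : 128 * (m n : ℝ) * aggK n * dim n * (logK n : ℝ) ^ 2 * lev n * (n : ℝ) ^ c * (n : ℝ) ^ kq ≤
        128 * (n : ℝ) ^ (km + kq + c + 8) := by
      have e1 : (logK n : ℝ) ^ 2 ≤ (n : ℝ) ^ 2 := pow_le_pow_left₀ (by linarith) hLn 2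
      calc 128 * (m n : ℝ) * aggK n * dim n * (logK n : ℝ) ^ 2 * lev n * (n : ℝ) ^ c * (n : ℝ) ^ kq
          ≤ 128 * (n : ℝ) ^ km * (n : ℝ) ^ 4 * n * (n : ℝ) ^ 2 * n * (n : ℝ) ^ c * (n : ℝ) ^ kq := by
            gcongr
        _ = 128 * (n : ℝ) ^ (km + kq + c + 8) := by ring
    have hbig := hprod.trans hQpow
    have hαk' : 1 ≤ α n * (n : ℝ) ^ kq := by rwa [div_le_iff₀ (by positivity)] at hαk
    have hK' : (aggK n : ℝ) - 1 ≤ aggK n := by linarith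
    have hK0 : 0 ≤ (aggK n : ℝ) - 1 := by linarith
    have hlhs : (m n : ℝ) * (((aggK n : ℝ) - 1) / (2 * ((2 ^ lev n : ℕ) : ℝ) * rate₁ α n)) =
        4 * (m n : ℝ) * ((aggK n : ℝ) - 1) * dim n * (logK n : ℝ) ^ 2 / (((2 ^ lev n : ℕ) : ℝ) * α n) := by
      rw [hr₁]
      field_simp
      ring
    rw [hlhs, div_le_div_iff₀ (by positivity) (by positivity), one_mul]
    calc 4 * (m n : ℝ) * ((aggK n : ℝ) - 1) * dim n * (logK n : ℝ) ^ 2 * (32 * (lev n : ℝ) * (n : ℝ) ^ c)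
        ≤ 4 * (m n : ℝ) * aggK n * dim n * (logK n : ℝ) ^ 2 * (32 * (lev n : ℝ) * (n : ℝ) ^ c) := by gcongr
      _ = (128 * (m n : ℝ) * aggK n * dim n * (logK n : ℝ) ^ 2 * lev n * (n : ℝ) ^ c * (n : ℝ) ^ kq) / (n : ℝ) ^ kq := by
          field_simp
          ring
      _ ≤ ((2 ^ lev n : ℕ) : ℝ) / (n : ℝ) ^ kq := by gcongr
      _ ≤ ((2 ^ lev n : ℕ) : ℝ) * α n := by
          rw [div_le_iff₀ (by positivity)]
          calc ((2 ^ lev n : ℕ) : ℝ) = ((2 ^ lev n : ℕ) : ℝ) * 1 := (mul_one _).symm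
            _ ≤ ((2 ^ lev n : ℕ) : ℝ) * (α n * (n : ℝ) ^ kq) := by gcongr
            _ = ((2 ^ lev n : ℕ) : ℝ) * α n * (n : ℝ) ^ kq := by ring
  -- `ε'`
  have hε : epsC c (m n) n = 1 / (32 * (lev n : ℝ) * (m n + 1) * (n : ℝ) ^ c) := rfl
  have hε0 : 0 < epsC c (m n) n := by rw [hε]; positivity
  have hε64 : epsC c (m n) n ≤ 1 / 64 := by
    have hm1 : (1 : ℝ) ≤ (m n : ℝ) + 1 := by linarith [(Nat.cast_nonneg (m n) : (0 : ℝ) ≤ m n)]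
    have h64 : (64 : ℝ) ≤ 32 * (lev n : ℝ) * (m n + 1) * (n : ℝ) ^ c := by
      calc (64 : ℝ) = 32 * 2 * 1 * 1 := by norm_num
        _ ≤ 32 * (lev n : ℝ) * (m n + 1) * (n : ℝ) ^ c := by gcongr
    rw [hε, div_le_div_iff₀ (by positivity) (by norm_num), one_mul, one_mul]
    exact h64
  have hεm : (m n : ℝ) * (epsC c (m n) n / (1 - epsC c (m n) n)) ≤ 1 / (16 * (lev n : ℝ) * (n : ℝ) ^ c) := by
    have h1 : epsC c (m n) n / (1 - epsC c (m n) n) ≤ 2 * epsC c (m n) n := by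
      rw [div_le_iff₀ (by linarith)]
      nlinarith
    calc (m n : ℝ) * (epsC c (m n) n / (1 - epsC c (m n) n)) ≤ (m n : ℝ) * (2 * epsC c (m n) n) := by gcongr
      _ = 2 * (m n : ℝ) / (32 * (lev n : ℝ) * (m n + 1) * (n : ℝ) ^ c) := by rw [hε]; ring
      _ ≤ 1 / (16 * (lev n : ℝ) * (n : ℝ) ^ c) := by
          rw [div_le_div_iff₀ (by positivity) (by positivity)]
          nlinarith [mul_pos (by positivity : (0 : ℝ) < 16 * (lev n : ℝ)) (by positivity : (0 : ℝ) < (n : ℝ) ^ c)]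
  have hadv : adv₀ c n / (2 * (lev n : ℝ)) = 1 / (4 * (lev n : ℝ) * (n : ℝ) ^ c) := by
    unfold adv₀; field_simp; ring
  refine ⟨?_, ?_, hε0, by linarith⟩
  · rw [hadv]
    have hpos : (0 : ℝ) < (lev n : ℝ) * (n : ℝ) ^ c := by positivity
    have hsum : 2 * (1 / (32 * (lev n : ℝ) * (n : ℝ) ^ c) + 1 / (16 * (lev n : ℝ) * (n : ℝ) ^ c)) <
        1 / (4 * (lev n : ℝ) * (n : ℝ) ^ c) := by
      rw [show 2 * (1 / (32 * (lev n : ℝ) * (n : ℝ) ^ c) + 1 / (16 * (lev n : ℝ) * (n : ℝ) ^ c)) =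
          3 / (16 * ((lev n : ℝ) * (n : ℝ) ^ c)) by field_simp; ring,
        div_lt_div_iff₀ (by positivity) (by positivity)]
      linarith only [hpos]
    have h2 := mul_le_mul_of_nonneg_left (add_le_add hΔ hεm) (show (0 : ℝ) ≤ 2 by norm_num)
    exact lt_of_le_of_lt h2 hsum
  · have hpos : (0 : ℝ) < (n : ℝ) ^ c := by positivity
    have h32 : 1 / (32 * (lev n : ℝ) * (n : ℝ) ^ c) ≤ 1 / (2 * (n : ℝ) ^ c) := by
      rw [div_le_div_iff₀ (by positivity) (by positivity), one_mul, one_mul]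
      have h := mul_le_mul_of_nonneg_right (show (2 : ℝ) ≤ 32 * lev n by linarith only [he2]) hpos.le
      linarith only [h]
    have hfin : 1 / (2 * (n : ℝ) ^ c) + 1 / (2 * (n : ℝ) ^ c) = 1 / (n : ℝ) ^ c := by
      field_simp
      ring
    have hadv₀ : adv₀ c n = 1 / (2 * (n : ℝ) ^ c) := rfl
    linarith only [hΔ, h32, hfin, hadv₀]

include hα in
/-- **The rounding-tail conditions hold eventually**: `θ > 0`, the margin
`r₀ = rate₂/(2θ) - 1/(2Q) ≥ 0`, and `extra·2e^{-πr₀²/rate₁²} ≤ 1/16` (the exponent is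
`≥ π²(ln n)³/(16k₁) = ω(log n)`, MP12's "`ℓ = ω(log n)`"). [cite: MicciancioPeikert2012, Thm. 3.1 proof (p. 16)] -/
theorem eventually_tail (hq : IsPolyBounded q) (hm : IsPolyBounded m) : ∀ᶠ n : ℕ in atTop,
    0 < theta c (m n) n ∧
      0 ≤ rate₂ α n / (2 * theta c (m n) n) - 1 / (2 * ((2 ^ lev n : ℕ) : ℝ)) ∧
      (extra n : ℝ) * (2 * Real.exp (-(π * (rate₂ α n / (2 * theta c (m n) n) - 1 / (2 * ((2 ^ lev n : ℕ) : ℝ))) ^ 2 /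
        rate₁ α n ^ 2))) ≤ 1 / 16 := by
  obtain ⟨kq, hkq⟩ := eventually_pow_inv_le_alpha hα hq
  obtain ⟨km, hkm⟩ := RegevReduction.IsPolyBounded.eventually_le_pow hm
  set k₁ : ℕ := km + c + 2 with hk₁
  have hlog_tend : Tendsto (fun n : ℕ => Real.log n) atTop atTop :=
    Real.tendsto_log_atTop.comp tendsto_natCast_atTop_atTop
  filter_upwards [hkq, hkm, eventually_ge_atTop 130, eventually_mul_pow_le_two_pow_lev (kq + 2) (16 * (k₁ + 1)),
    hlog_tend.eventually_ge_atTop (48 * (k₁ : ℝ))] with n ⟨hα0, hα1, hαk, hq0, hqk⟩ hmn hn130 hpow hlogbig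
  obtain ⟨hd, hL, he⟩ := crude_bounds (show 2 ≤ n by omega)
  have hn : (130 : ℝ) ≤ n := by exact_mod_cast hn130
  have hn1 : (1 : ℝ) ≤ n := by linarith only [hn]
  have hdr : (1 : ℝ) ≤ dim n := by exact_mod_cast one_le_dim (show 1 ≤ n by omega)
  have hdn : (dim n : ℝ) ≤ n := by exact_mod_cast hd
  have hLn : (logK n : ℝ) ≤ n := by exact_mod_cast hL
  have hen : (lev n : ℝ) ≤ n := by exact_mod_cast he
  have he2 : (2 : ℝ) ≤ lev n := by exact_mod_cast two_le_lev n
  have hmr : (m n : ℝ) ≤ (n : ℝ) ^ km := by exact_mod_cast hmn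
  have hnc : (1 : ℝ) ≤ (n : ℝ) ^ c := one_le_pow₀ hn1
  have hk₁1 : (1 : ℝ) ≤ k₁ := by rw [hk₁]; push_cast; linarith only [(Nat.cast_nonneg km : (0 : ℝ) ≤ km), (Nat.cast_nonneg c : (0 : ℝ) ≤ c)]
  have hlog1 : 1 ≤ Real.log n := le_trans (by linarith only [hk₁1]) hlogbig
  have hlogn : Real.log n ≤ n := (Real.log_le_sub_one_of_pos (by linarith only [hn])).trans (by linarith only [hn])
  have hlogK := log_le_logK n
  set Q : ℝ := ((2 ^ lev n : ℕ) : ℝ) with hQdef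
  have hQ : 0 < Q := by rw [hQdef]; positivity
  have hQpow : 16 * ((k₁ : ℝ) + 1) * (n : ℝ) ^ (kq + 2) ≤ Q := by rw [hQdef]; exact_mod_cast hpow
  -- `ε'`, `B = 2(1 + 1/ε')`, `θ`
  set ε : ℝ := epsC c (m n) n with hεdef
  have hε : ε = 1 / (32 * (lev n : ℝ) * (m n + 1) * (n : ℝ) ^ c) := rfl
  have hε0 : 0 < ε := by rw [hε]; positivity
  set B : ℝ := 2 * (1 + 1 / ε) with hBdef
  have hBε : B = 2 + 64 * (lev n : ℝ) * (m n + 1) * (n : ℝ) ^ c := by rw [hBdef, hε]; field_simp; ring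
  have hB2 : 2 ≤ B := by rw [hBε]; linarith only [show (0 : ℝ) ≤ 64 * (lev n : ℝ) * (m n + 1) * (n : ℝ) ^ c by positivity]
  have hBpoly : B ≤ (n : ℝ) ^ k₁ := by
    rw [hBε, hk₁]
    calc 2 + 64 * (lev n : ℝ) * (m n + 1) * (n : ℝ) ^ c ≤ 2 + 64 * n * ((n : ℝ) ^ km + (n : ℝ) ^ km) * (n : ℝ) ^ c := by
          gcongr
          exact one_le_pow₀ hn1
      _ = 2 + 128 * (n : ℝ) ^ (km + c + 1) := by ring
      _ ≤ 130 * (n : ℝ) ^ (km + c + 1) := by linarith only [one_le_pow₀ (n := km + c + 1) hn1]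
      _ ≤ n * (n : ℝ) ^ (km + c + 1) := by gcongr
      _ = (n : ℝ) ^ (km + c + 2) := by ring
  have hlogB : Real.log B ≤ k₁ * Real.log n := by
    rw [← Real.log_pow]
    exact Real.log_le_log (by linarith only [hB2]) hBpoly
  have hlogB0 : 0 < Real.log B := Real.log_pos (by linarith only [hB2])
  set θ : ℝ := theta c (m n) n with hθdef
  have hθ : θ = Real.sqrt (Real.log B / π) := rfl
  have hθsq : θ ^ 2 = Real.log B / π := by rw [hθ, Real.sq_sqrt (by positivity)]
  have hθ0 : 0 < θ := by rw [hθ]; exact Real.sqrt_pos.2 (by positivity)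
  have hπ : 1 ≤ π := by linarith only [Real.two_le_pi]
  have hθsq_le : θ ^ 2 ≤ k₁ * Real.log n := by
    rw [hθsq, div_le_iff₀ Real.pi_pos]
    calc Real.log B ≤ k₁ * Real.log n := hlogB
      _ = k₁ * Real.log n * 1 := (mul_one _).symm
      _ ≤ k₁ * Real.log n * π := by gcongr
  have hθle : θ ≤ ((k₁ : ℝ) + 1) * n := by
    have h1 : θ ≤ θ ^ 2 + 1 := by nlinarith only [sq_nonneg (θ - 1)]
    calc θ ≤ θ ^ 2 + 1 := h1
      _ ≤ k₁ * Real.log n + 1 := by linarith only [hθsq_le]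
      _ ≤ k₁ * n + n := by gcongr
      _ = ((k₁ : ℝ) + 1) * n := by ring
  -- the rates
  have hr₂ : rate₂ α n = α n / (8 * dim n) := rfl
  have hr₁ : rate₁ α n = rate₂ α n / (logK n : ℝ) ^ 2 := rfl
  have hr₂0 : 0 < rate₂ α n := by rw [hr₂]; positivity
  have hL1 : (1 : ℝ) ≤ logK n := by exact_mod_cast one_le_logK n
  have hr₁0 : 0 < rate₁ α n := by rw [hr₁]; positivity
  -- Step 2: `2θ ≤ Q·rate₂`
  have hαk' : 1 ≤ α n * (n : ℝ) ^ kq := by rwa [div_le_iff₀ (by positivity)] at hαk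
  have hQα : 16 * ((k₁ : ℝ) + 1) * (n : ℝ) ^ 2 ≤ Q * α n := by
    have h1 : 16 * ((k₁ : ℝ) + 1) * (n : ℝ) ^ 2 * (n : ℝ) ^ kq ≤ Q := by
      calc 16 * ((k₁ : ℝ) + 1) * (n : ℝ) ^ 2 * (n : ℝ) ^ kq = 16 * ((k₁ : ℝ) + 1) * (n : ℝ) ^ (kq + 2) := by ring
        _ ≤ Q := hQpow
    calc 16 * ((k₁ : ℝ) + 1) * (n : ℝ) ^ 2 = 16 * ((k₁ : ℝ) + 1) * (n : ℝ) ^ 2 * 1 := (mul_one _).symm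
      _ ≤ 16 * ((k₁ : ℝ) + 1) * (n : ℝ) ^ 2 * (α n * (n : ℝ) ^ kq) := by gcongr
      _ = 16 * ((k₁ : ℝ) + 1) * (n : ℝ) ^ 2 * (n : ℝ) ^ kq * α n := by ring
      _ ≤ Q * α n := by gcongr
  have h2θ : 2 * θ ≤ Q * rate₂ α n := by
    rw [hr₂, mul_div_assoc', le_div_iff₀ (by positivity)]
    calc 2 * θ * (8 * dim n) ≤ 2 * (((k₁ : ℝ) + 1) * n) * (8 * n) := by gcongr
      _ = 16 * ((k₁ : ℝ) + 1) * (n : ℝ) ^ 2 := by ring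
      _ ≤ Q * α n := hQα
  -- the margin `r ≥ rate₂/(4θ) ≥ 0`
  set r : ℝ := rate₂ α n / (2 * θ) - 1 / (2 * Q) with hrdef
  have hr4 : rate₂ α n / (4 * θ) ≤ r := by
    have h1 : 1 / (2 * Q) ≤ rate₂ α n / (4 * θ) := by
      rw [div_le_div_iff₀ (by positivity) (by positivity)]
      linarith only [h2θ]
    have h2 : rate₂ α n / (2 * θ) = rate₂ α n / (4 * θ) + rate₂ α n / (4 * θ) := by field_simp; ring
    rw [hrdef, h2]
    linarith only [h1]
  have hr40 : 0 ≤ rate₂ α n / (4 * θ) := by positivity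
  have hr0 : 0 ≤ r := hr40.trans hr4
  -- Step 3: the exponent is `≥ 3·log n`
  have hu : (logK n : ℝ) ^ 2 / (4 * θ) ≤ r / rate₁ α n := by
    rw [hr₁, div_div_eq_mul_div, le_div_iff₀ hr₂0]
    calc (logK n : ℝ) ^ 2 / (4 * θ) * rate₂ α n = rate₂ α n / (4 * θ) * (logK n : ℝ) ^ 2 := by ring
      _ ≤ r * (logK n : ℝ) ^ 2 := by gcongr
  have hu0 : 0 ≤ (logK n : ℝ) ^ 2 / (4 * θ) := by positivity
  have hlog0 : 0 ≤ Real.log n := by linarith only [hlog1]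
  have hE : 3 * Real.log n ≤ π * r ^ 2 / rate₁ α n ^ 2 := by
    have h1 : ((logK n : ℝ) ^ 2 / (4 * θ)) ^ 2 ≤ (r / rate₁ α n) ^ 2 := pow_le_pow_left₀ hu0 hu 2
    have h2 : π * r ^ 2 / rate₁ α n ^ 2 = π * (r / rate₁ α n) ^ 2 := by rw [div_pow]; ring
    rw [h2]
    -- `π·(logK²/(4θ))² = π·logK⁴/(16θ²) ≥ logK⁴/(16·k₁·log n) ≥ (log n)³/(16k₁) ≥ 3 log n`
    have h3 : Real.log n ^ 4 / (16 * (k₁ * Real.log n)) ≤ ((logK n : ℝ) ^ 2 / (4 * θ)) ^ 2 := by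
      rw [div_pow, show ((logK n : ℝ) ^ 2) ^ 2 = (logK n : ℝ) ^ 4 by ring,
        show (4 * θ) ^ 2 = 16 * θ ^ 2 by ring]
      have hθ2pos : 0 < θ ^ 2 := by positivity
      calc Real.log n ^ 4 / (16 * (k₁ * Real.log n)) ≤ Real.log n ^ 4 / (16 * θ ^ 2) := by
            gcongr
        _ ≤ (logK n : ℝ) ^ 4 / (16 * θ ^ 2) := by
            gcongr
    have h4 : 3 * Real.log n ≤ Real.log n ^ 4 / (16 * (k₁ * Real.log n)) := by
      rw [le_div_iff₀ (by positivity)]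
      have a1 : 48 * (k₁ : ℝ) ≤ Real.log n ^ 2 := hlogbig.trans (by nlinarith only [hlog1])
      calc 3 * Real.log n * (16 * (k₁ * Real.log n)) = 48 * (k₁ : ℝ) * Real.log n ^ 2 := by ring
        _ ≤ Real.log n ^ 2 * Real.log n ^ 2 := by gcongr
        _ = Real.log n ^ 4 := by ring
    calc 3 * Real.log n ≤ Real.log n ^ 4 / (16 * (k₁ * Real.log n)) := h4
      _ ≤ ((logK n : ℝ) ^ 2 / (4 * θ)) ^ 2 := h3
      _ ≤ (r / rate₁ α n) ^ 2 := h1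
      _ = 1 * (r / rate₁ α n) ^ 2 := (one_mul _).symm
      _ ≤ π * (r / rate₁ α n) ^ 2 := by gcongr
  -- Step 4: `extra·2·e^{-E} ≤ (n+4)·2/n³ ≤ 1/16`
  have hexp : Real.exp (-(π * r ^ 2 / rate₁ α n ^ 2)) ≤ 1 / (n : ℝ) ^ 3 := by
    calc Real.exp (-(π * r ^ 2 / rate₁ α n ^ 2)) ≤ Real.exp (-(3 * Real.log n)) := Real.exp_le_exp.2 (by linarith only [hE])
      _ = 1 / (n : ℝ) ^ 3 := by
          rw [show -(3 * Real.log n) = -(Real.log ((n : ℝ) ^ 3)) by rw [Real.log_pow]; push_cast; ring,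
            Real.exp_neg, Real.exp_log (by positivity), one_div]
  have hextra : (extra n : ℝ) ≤ n + 4 := by unfold extra; push_cast; linarith only [hdn]
  refine ⟨hθ0, hr0, ?_⟩
  calc (extra n : ℝ) * (2 * Real.exp (-(π * r ^ 2 / rate₁ α n ^ 2))) ≤ (n + 4) * (2 * (1 / (n : ℝ) ^ 3)) := by gcongr
    _ = 2 * ((n : ℝ) + 4) / (n : ℝ) ^ 3 := by ring
    _ ≤ 1 / 16 := by
        rw [div_le_div_iff₀ (by positivity) (by norm_num)]
        have h3 : (130 : ℝ) * 130 * n ≤ (n : ℝ) ^ 3 := by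
          have h := mul_le_mul_of_nonneg_right (mul_le_mul hn hn (by norm_num) (by linarith only [hn]))
            (show (0 : ℝ) ≤ n by linarith only [hn])
          calc (130 : ℝ) * 130 * n ≤ n * n * n := h
            _ = (n : ℝ) ^ 3 := by ring
        linarith only [h3, hn]

end Eventually

end MP12

end LWE

end Literature.Computability.Cryptography

end
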